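import Summits.CriticalPhenomena.PercolationContinuityZ3.Theorems.Transplant.SkelPhiWindowSpans
import HarnessLib

/-!
# N1 scheme geometry over a NON-STEP window map: the MARGIN METHOD — containments of vertex-span windows `VWin G ψ w₀ A r ⊆ VWin G ψ w₀ B r′ ∪ VWin G ψ w₀ B′ r″`
# from a planar cover `A ⊆ B ∪ B′` with an ADJACENCY MARGIN (every two sup-adjacent points of `A` lie together in `B` or together in `B′`) and `Lip G ψ` only —
# no `Steps G ψ` (false for the cell-aligned maps ψ = fineSkel∘φ of the {±1} node: a vertex near a corner of its ψ-unit cell may have no neighbour in that cell)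

These replace, for the N1 port of `sepGeomSG/sepGeom₂SG/stepsGeomSG` (SkelPhiCellsConcG/…GLevels), every use of the step device `mem_VWin_of_zdAdj (hstep)`; the one place
needing a vertex with PRESCRIBED ψ-value (`col_Q`) is served by representative lemmas (hp-8's `exists_mem_graphBall_φ_eq_rep`), not here.
builds on p205010 (kernel theorem, internal audit signed; external expert review pending) — nothing here uses p205010.  Lane `prim-bschramm`, seat `prim-bschramm-p3` (gen 8;
design owner); helper file (`--supports stmt-CriticalPhenomena-4575`); NEG-SCOPE addendum B.5.
[cite: KozmaNitzan2024, §4 pp. 25–26 (the cell/corridor containments)] [folklore]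
-/

noncomputable section

namespace Summit.CriticalPhenomena.PercolationContinuityZ3.Theorems

namespace Transplant

namespace Skelφ

open Literature.Probability.Percolation Literature.Probability.LatticeModels SimpleGraph KNCells
open Literature.Barriers.CriticalPhenomena (graphBall graphBall_finite mem_graphBall_self graphBall_mono)
open PlanarSkeletonConc (mem_vspan_edgesIn_iff mem_vspan_edgesIn_of_adj)
open scoped Classical

variable {V : Type} [DecidableEq V] {G : SimpleGraph V} [G.LocallyFinite] {ψ : V → Site 2}

/-- **Sup-adjacency of planar points**: `‖s − s′‖_∞ ≤ 1`. [folklore] -/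
def SupAdj (s s' : Site 2) : Prop := ∀ i : Fin 2, |s i - s' i| ≤ 1

omit [DecidableEq V] [G.LocallyFinite] in
/-- A `Lip` map sends `G`-edges to sup-adjacent points. [folklore] -/
theorem supAdj_of_adj (hlip : Lip G ψ) {y z : V} (h : G.Adj y z) : SupAdj (ψ y) (ψ z) := fun i => hlip h i

/-- **The adjacency margin** of a cover `A ⊆ B ∪ B′`: every two sup-adjacent points of `A` lie together in `B` or together in `B′`. [this work] -/
def AdjMargin (A B B' : Finset (Site 2)) : Prop := ∀ s ∈ A, ∀ s' ∈ A, SupAdj s s' → (s ∈ B ∧ s' ∈ B) ∨ (s ∈ B' ∧ s' ∈ B')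

/-- **The margin method**: `VWin ψ A r ⊆ VWin ψ B r′ ∪ VWin ψ B′ r″` for a cover with adjacency margin and `Lip ψ` (`r ≤ r′`, `r ≤ r″`). [this work] -/
theorem VWin_subset_union_of_margin (hlip : Lip G ψ) {w₀ : V} {A B B' : Finset (Site 2)} (hM : AdjMargin A B B') {r r' r'' : ℕ} (h' : r ≤ r')
    (h'' : r ≤ r'') : VWin G ψ w₀ A r ⊆ VWin G ψ w₀ B r' ∪ VWin G ψ w₀ B' r'' := by
  intro y hy
  rw [VWin, mem_vspan_edgesIn_iff] at hy
  obtain ⟨hyW, z, hzW, hadj⟩ := hy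
  rw [mem_Win] at hyW hzW
  rw [Finset.mem_union]
  rcases hM _ hyW.2 _ hzW.2 (supAdj_of_adj hlip hadj) with ⟨hyB, hzB⟩ | ⟨hyB, hzB⟩
  · left
    exact (mem_vspan_edgesIn_of_adj ((mem_Win G ψ).2 ⟨graphBall_mono G w₀ h' hyW.1, hyB⟩) ((mem_Win G ψ).2 ⟨graphBall_mono G w₀ h' hzW.1, hzB⟩) hadj).1
  · right
    exact (mem_vspan_edgesIn_of_adj ((mem_Win G ψ).2 ⟨graphBall_mono G w₀ h'' hyW.1, hyB⟩) ((mem_Win G ψ).2 ⟨graphBall_mono G w₀ h'' hzW.1, hzB⟩) hadj).1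

/-- **One-set form**: `VWin ψ A r ⊆ VWin ψ B r′` when `A ⊆ B` (no margin needed). [folklore] -/
theorem VWin_subset_of_subset {w₀ : V} {A B : Finset (Site 2)} (hAB : A ⊆ B) {r r' : ℕ} (h' : r ≤ r') : VWin G ψ w₀ A r ⊆ VWin G ψ w₀ B r' :=
  VWin_mono hAB h'

/-- **A sufficient condition for the margin**: `A ⊆ B ∪ B′` and the two differences `A ∖ B′`, `A ∖ B` contain no sup-adjacent pair (they are ≥ 2 apart in the sup-norm).
[folklore] -/
theorem adjMargin_of_far {A B B' : Finset (Site 2)} (hcov : A ⊆ B ∪ B') (hfar : ∀ s ∈ A, s ∉ B' → ∀ s' ∈ A, s' ∉ B → ¬ SupAdj s s') : AdjMargin A B B' := by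
  intro s hs s' hs' hss'
  by_cases h1 : s ∈ B
  · by_cases h2 : s' ∈ B
    · exact Or.inl ⟨h1, h2⟩
    · -- `s' ∈ B'`; then `s ∈ B'` too, else `s ∉ B'`, `s' ∉ B` are sup-adjacent
      have hs'B' : s' ∈ B' := (Finset.mem_union.1 (hcov hs')).resolve_left h2
      by_cases h3 : s ∈ B'
      · exact Or.inr ⟨h3, hs'B'⟩
      · exact absurd hss' (hfar s hs h3 s' hs' h2)
  · have hsB' : s ∈ B' := (Finset.mem_union.1 (hcov hs)).resolve_left h1
    by_cases h2 : s' ∈ B'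
    · exact Or.inr ⟨hsB', h2⟩
    · have hs'B : s' ∈ B := (Finset.mem_union.1 (hcov hs')).resolve_right h2
      have hsym : SupAdj s' s := fun i => by rw [abs_sub_comm]; exact hss' i
      exact absurd hsym (hfar s' hs' h2 s hs h1)

/-- **Boxes give margins**: if `A ⊆ B ∪ B′` where `B ⊇ {s ∈ A | s i ≤ c}` … concretely, for a coordinate `i` and a threshold `c`: all points of `A` with `s i ≤ c + 1` lie in `B` and all
points of `A` with `c ≤ s i` lie in `B′`; then the cover has the adjacency margin. [folklore] -/
theorem adjMargin_of_threshold {A B B' : Finset (Site 2)} (i : Fin 2) (c : ℤ) (hB : ∀ s ∈ A, s i ≤ c + 1 → s ∈ B) (hB' : ∀ s ∈ A, c ≤ s i → s ∈ B') :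
    AdjMargin A B B' := by
  intro s hs s' hs' hss'
  have hi := hss' i
  rcases le_or_gt (s i) c with h1 | h1
  · -- `s i ≤ c`, so `s' i ≤ c + 1`
    exact Or.inl ⟨hB s hs (by omega), hB s' hs' (by have := (abs_le.1 hi).1; omega)⟩
  · exact Or.inr ⟨hB' s hs h1.le, hB' s' hs' (by have := (abs_le.1 hi).2; omega)⟩

end Skelφ

end Transplant

end Summit.CriticalPhenomena.PercolationContinuityZ3.Theorems

end
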